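import Summits.AtomisticToContinuum.Crystallization.Theorems.PalmUnimodularRigidityMinimiserShellsEnergyFloor
import Summits.AtomisticToContinuum.Crystallization.Theorems.PalmUnimodularRigidityMinimiserShellsEquilibriumInLawShells
import Summits.AtomisticToContinuum.Crystallization.Theorems.PalmUnimodularRigidityCruxesToPalmRigidity

/-!
# Slack certificates, part A: uniform boundary error and transport bounds
(line `octahedral-annulus-mandate` of crux `MinimiserShells`, stmt-AtomisticToContinuum-9225; part (i) of
stub `stub_capCertificates`)

Route `PalmUnimodularRigidity`, crux decl
`Summit.AtomisticToContinuum.Crystallization.Theses.PalmUnimodularRigidity.MinimiserShells`, lead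
`prover-line-stmt-AtomisticToContinuum-9225-a1-0`.

**Theorem** (`stub_slackCertificates`, in part B `…SlackCertificates.lean`; this file holds its lemmas and
the registered marker `stub_slackCertificates_part01` = the uniform boundary error, closed form).  For every hard core `δ > 0` and every slack `ε > 0` there are
`R, M` and a transfer `t : (configuration, atom) → ℝ` which is jointly measurable, bounded by `M` and of
range `R`, such that for EVERY rooted `δ`-hard-core configuration `μ`
`e* − ε ≤ h(μ) + div t(μ)`, `div t(μ) = ∫ (t(μ, y) − t(θ_y μ, −y)) dμ(y)` (mass sent minus mass received,
`θ_y μ = μ.map (· − y)`), `h(μ) = ½ ∫ V_LJ(‖y‖) dμ` the root energy.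

This is part (i) of the registered stub `stub_capCertificates` of the line (the universal slack-`ε`
certificate; part (ii) asks in addition for a margin `c > 0` at CAPLESS roots).  The line card derives (i)
abstractly from Sion's minimax theorem and the energy floor `e_uni ≥ e*` (item 9229); here it is proved
CONSTRUCTIVELY: the random-grid mass transport of the landed proof of 9229
(`EnergyFloor.transport δ L`, files `…EnergyFloorDefs/A–E/EnergyFloor`) is itself a pointwise certificate.
With `t = −(vol [0,1)³)⁻¹ · transport` (truncated at its hard-core bound to make it bounded on all inputs):
mass received `≥ vol·(e* + C_δ)` by periodisation of the root's cluster (`le_lintegral_transport_map`),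
mass sent `=` phase average of `local energy + C_δ` (`lintegral_transport_eq`)
`≤ vol·(h + C_δ) + err_L(μ)/12` (`setLIntegral_ofReal_locEnergy_le`), so `h + div t ≥ e* − err_L(μ)/(12·vol)`.
The new ingredient is a bound on the boundary error UNIFORM over `δ`-hard-core configurations
(`errTerm_le_uniform`): a point of norm `≤ ρ` is cut from the root by the random grid of mesh `L` with
probability `≤ 6ρ/L` (`phaseOut_le_of_norm_le`, union of six slabs of the phase cube), and the points beyond
`ρ` contribute `≤ 1000 δ⁻⁴ ρ⁻²` (`EquilibriumInLaw.Shells.sum_inv_pow_six_le_of_far`); choosing `ρ` then `L`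
makes `err_L ≤ 12·vol·ε` for all `μ` at once.
-/

noncomputable section

open MeasureTheory Filter Set
open scoped ENNReal BigOperators Topology

namespace Summit.AtomisticToContinuum.Crystallization.Theorems.PalmUnimodularRigidityMinimiserShells.SlackCertificates

open Literature.Probability.Process (IsRootedHardCore IsPointStationaryLaw)
open Literature.MathematicalPhysics.StatisticalMechanics (lennardJones rootEnergy)
open Summit.AtomisticToContinuum.Crystallization.Theorems.MinimiserShells.Negative.LoadBearing (eStar meanRootEnergy)
open Summit.AtomisticToContinuum.Crystallization.Theorems.MinimiserShells.Negative.Rootedness (E3 countable_of_separated)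
open Summit.AtomisticToContinuum.Crystallization.Theorems.PalmUnimodularRigidityMinimiserShells.EnergyFloor
open Summit.AtomisticToContinuum.Crystallization.Theorems.PalmUnimodularRigidityMinimiserShells.EquilibriumInLaw.Shells
  (sum_inv_pow_six_le_of_far)

/-! ## Slabs of the unit cube and their volume -/

/-- The coordinate box `{v | ∀ j, lo j ≤ v j ≤ hi j}` of `ℝ³` has volume `∏ (hi j − lo j)`. -/
theorem volume_coordBox (lo hi : Fin 3 → ℝ) :
    volume {v : E3 | ∀ j, lo j ≤ v j ∧ v j ≤ hi j} = ∏ j, ENNReal.ofReal (hi j - lo j) := by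
  have hpre : {v : E3 | ∀ j, lo j ≤ v j ∧ v j ≤ hi j} = WithLp.ofLp ⁻¹' Icc lo hi := by
    ext v; simp [Pi.le_def, mem_Icc, forall_and]
  rw [hpre, (PiLp.volume_preserving_ofLp (Fin 3)).measure_preimage measurableSet_Icc.nullMeasurableSet,
    Real.volume_Icc_pi]

/-- A coordinate slab of the closed unit cube, `{v ∈ [0,1]³ | a ≤ v i ≤ b}`, has volume `≤ (b − a)⁺`. -/
theorem volume_slab_le (i : Fin 3) (a b : ℝ) :
    volume {v : E3 | (∀ j, 0 ≤ v j ∧ v j ≤ 1) ∧ a ≤ v i ∧ v i ≤ b} ≤ ENNReal.ofReal (b - a) := by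
  classical
  set lo : Fin 3 → ℝ := fun j => if j = i then a else 0 with hlo
  set hi : Fin 3 → ℝ := fun j => if j = i then b else 1 with hhi
  have hsub : {v : E3 | (∀ j, 0 ≤ v j ∧ v j ≤ 1) ∧ a ≤ v i ∧ v i ≤ b} ⊆
      {v : E3 | ∀ j, lo j ≤ v j ∧ v j ≤ hi j} := by
    rintro v ⟨hv, ha, hb⟩ j
    by_cases hj : j = i
    · subst hj; simp [hlo, hhi, ha, hb]
    · simp [hlo, hhi, hj, hv j]
  calc volume {v : E3 | (∀ j, 0 ≤ v j ∧ v j ≤ 1) ∧ a ≤ v i ∧ v i ≤ b}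
      ≤ volume {v : E3 | ∀ j, lo j ≤ v j ∧ v j ≤ hi j} := measure_mono hsub
    _ = ∏ j, ENNReal.ofReal (hi j - lo j) := volume_coordBox lo hi
    _ = ENNReal.ofReal (b - a) := by
        rw [Finset.prod_eq_single i (fun j _ hj => by simp [hlo, hhi, hj]) (fun h => absurd (Finset.mem_univ i) h)]
        simp [hlo, hhi]

/-! ## Uniform smallness of the boundary phases -/

/-- **A point of norm `≤ ρ` is cut from the root by the grid of mesh `L > 0` with probability `≤ 6ρ/L`**:
if every phase coordinate lies in `(ρ/L, 1 − ρ/L)` the point and the root share their cell, so the bad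
phases lie in six coordinate slabs of width `ρ/L` of the unit cube. -/
theorem phaseOut_le_of_norm_le {L ρ : ℝ} (hL : 0 < L) (hρ : 0 ≤ ρ) {z : E3} (hz : ‖z‖ ≤ ρ) :
    phaseOut L z ≤ 6 * ENNReal.ofReal (ρ / L) := by
  have hρL : 0 ≤ ρ / L := div_nonneg hρ hL.le
  -- the six slabs
  set A : Fin 3 → Set E3 := fun i => {v : E3 | (∀ j, 0 ≤ v j ∧ v j ≤ 1) ∧ 0 ≤ v i ∧ v i ≤ ρ / L} with hA
  set B : Fin 3 → Set E3 := fun i =>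
    {v : E3 | (∀ j, 0 ≤ v j ∧ v j ≤ 1) ∧ 1 - ρ / L ≤ v i ∧ v i ≤ 1} with hB
  -- containment of the bad phases
  have hsub : {v : E3 | cellIdx L v z ≠ cellIdx L v 0} ∩ phaseDom ⊆ ⋃ i, (A i ∪ B i) := by
    rintro v ⟨hv, hvD⟩
    rw [mem_phaseDom] at hvD
    have hcube : ∀ j, 0 ≤ v j ∧ v j ≤ 1 := fun j => ⟨(hvD j).1, (hvD j).2.le⟩
    by_contra hnot
    simp only [mem_iUnion, mem_union, not_exists, not_or] at hnot
    apply hv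
    funext i
    obtain ⟨hnA, hnB⟩ := hnot i
    have h1 : ρ / L < v i := by
      by_contra h; push Not at h
      exact hnA ⟨hcube, (hvD i).1, h⟩
    have h2 : v i < 1 - ρ / L := by
      by_contra h; push Not at h
      exact hnB ⟨hcube, h, (hvD i).2.le⟩
    have hzi : |z i| ≤ ρ := (by simpa using PiLp.norm_apply_le z i : |z i| ≤ ‖z‖).trans hz
    have hzi' : |z i / L| ≤ ρ / L := by
      rw [abs_div, abs_of_pos hL]; exact div_le_div_of_nonneg_right hzi hL.le
    rw [abs_le] at hzi'
    show ⌊z i / L - v i⌋ = ⌊(0 : E3) i / L - v i⌋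
    rw [PiLp.zero_apply, zero_div, zero_sub]
    have hr : ⌊-v i⌋ = -1 := by
      rw [Int.floor_eq_iff]; push_cast; constructor <;> linarith
    rw [hr, Int.floor_eq_iff]; push_cast; constructor <;> linarith
  -- volumes
  have hvA : ∀ i, volume (A i) ≤ ENNReal.ofReal (ρ / L) := fun i => by
    have := volume_slab_le i 0 (ρ / L); rwa [sub_zero] at this
  have hvB : ∀ i, volume (B i) ≤ ENNReal.ofReal (ρ / L) := fun i => by
    have := volume_slab_le i (1 - ρ / L) 1; rwa [sub_sub_cancel] at this
  unfold phaseOut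
  rw [Measure.restrict_apply' measurableSet_phaseDom]
  calc volume ({v : E3 | cellIdx L v z ≠ cellIdx L v 0} ∩ phaseDom)
      ≤ volume (⋃ i, (A i ∪ B i)) := measure_mono hsub
    _ ≤ ∑ i, volume (A i ∪ B i) := measure_iUnion_fintype_le _ _
    _ ≤ ∑ i, (volume (A i) + volume (B i)) := Finset.sum_le_sum fun i _ => measure_union_le _ _
    _ ≤ ∑ _i : Fin 3, (ENNReal.ofReal (ρ / L) + ENNReal.ofReal (ρ / L)) :=
        Finset.sum_le_sum fun i _ => add_le_add (hvA i) (hvB i)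
    _ = 6 * ENNReal.ofReal (ρ / L) := by
        rw [Finset.sum_const, Finset.card_univ, Fintype.card_fin, nsmul_eq_mul]
        push_cast; ring

/-- **Tail of the shell sum**: the points of a `δ`-separated set beyond distance `ρ ≥ δ` from the root
contribute `∑ ‖z‖⁻⁶ ≤ 1000 δ⁻⁴ ρ⁻²` (as a `lintegral` against the counting measure). -/
theorem lintegral_indicator_inv_six_le {δ ρ : ℝ} (hδ : 0 < δ) (hδρ : δ ≤ ρ) {S : Set E3}
    (hsep : ∀ x ∈ S, ∀ y ∈ S, x ≠ y → δ ≤ dist x y) :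
    ∫⁻ z, {z : E3 | ρ ≤ ‖z‖}.indicator (fun z => ENNReal.ofReal (‖z‖⁻¹ ^ 6)) z
        ∂((Measure.count : Measure E3).restrict S) ≤ ENNReal.ofReal (1000 * δ⁻¹ ^ 4 * ρ⁻¹ ^ 2) := by
  classical
  refine lintegral_count_restrict_le_of_sum_le (countable_of_separated hδ hsep) fun T hT => ?_
  have hsplit : ∑ z ∈ T, {z : E3 | ρ ≤ ‖z‖}.indicator (fun z => ENNReal.ofReal (‖z‖⁻¹ ^ 6)) z =
      ∑ z ∈ T.filter (fun z => ρ ≤ ‖z‖), ENNReal.ofReal (‖z‖⁻¹ ^ 6) := by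
    rw [Finset.sum_filter]
    refine Finset.sum_congr rfl fun z _ => ?_
    by_cases h : ρ ≤ ‖z‖
    · rw [indicator_of_mem (show z ∈ {z : E3 | ρ ≤ ‖z‖} from h), if_pos h]
    · rw [indicator_of_notMem (show z ∉ {z : E3 | ρ ≤ ‖z‖} from h), if_neg h]
  rw [hsplit, ← ENNReal.ofReal_sum_of_nonneg fun z _ => by positivity]
  refine ENNReal.ofReal_le_ofReal ?_
  have h := sum_inv_pow_six_le_of_far (T.filter fun z => ρ ≤ ‖z‖) 0 hδ hδρ
    (fun z hz => by rw [dist_zero_left]; exact (Finset.mem_filter.1 hz).2)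
    (fun z hz w hw hzw => hsep z (hT (Finset.mem_filter.1 hz).1) w (hT (Finset.mem_filter.1 hw).1) hzw)
  simpa [dist_zero_left] using h

/-- **Uniform boundary error.**  For a rooted `δ`-hard-core configuration, mesh `L > 0` and cut-off
`ρ ≥ δ`: `err_L(μ) ≤ 6(ρ/L)·250 δ⁻⁶ + vol [0,1)³ · 1000 δ⁻⁴ ρ⁻²` — a bound that does not depend on `μ`. -/
theorem errTerm_le_uniform {δ L ρ : ℝ} (hδ : 0 < δ) (hL : 0 < L) (hδρ : δ ≤ ρ) {μ : Measure E3}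
    (hμ : IsRootedHardCore δ μ) :
    errTerm L μ ≤ 6 * ENNReal.ofReal (ρ / L) * ENNReal.ofReal (250 * δ⁻¹ ^ 6) +
      volume phaseDom * ENNReal.ofReal (1000 * δ⁻¹ ^ 4 * ρ⁻¹ ^ 2) := by
  have hρ : 0 ≤ ρ := hδ.le.trans hδρ
  have hμ' := hμ
  obtain ⟨S, h0, hsep, rfl⟩ := hμ
  set g₁ : E3 → ℝ≥0∞ := fun z => (6 * ENNReal.ofReal (ρ / L)) * ENNReal.ofReal (‖z‖⁻¹ ^ 6) with hg₁
  set g₂ : E3 → ℝ≥0∞ := fun z =>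
    volume phaseDom * {z : E3 | ρ ≤ ‖z‖}.indicator (fun z => ENNReal.ofReal (‖z‖⁻¹ ^ 6)) z with hg₂
  have hpt : ∀ z : E3, ENNReal.ofReal (‖z‖⁻¹ ^ 6) * phaseOut L z ≤ g₁ z + g₂ z := by
    intro z
    by_cases hz : ‖z‖ ≤ ρ
    · calc ENNReal.ofReal (‖z‖⁻¹ ^ 6) * phaseOut L z
          ≤ ENNReal.ofReal (‖z‖⁻¹ ^ 6) * (6 * ENNReal.ofReal (ρ / L)) :=
            mul_le_mul' le_rfl (phaseOut_le_of_norm_le hL hρ hz)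
        _ = g₁ z := by rw [hg₁, mul_comm]
        _ ≤ g₁ z + g₂ z := le_self_add
    · push Not at hz
      calc ENNReal.ofReal (‖z‖⁻¹ ^ 6) * phaseOut L z
          ≤ ENNReal.ofReal (‖z‖⁻¹ ^ 6) * volume phaseDom := mul_le_mul' le_rfl (phaseOut_le L z)
        _ = g₂ z := by
            rw [hg₂, mul_comm]
            simp only
            rw [indicator_of_mem (show z ∈ {z : E3 | ρ ≤ ‖z‖} from hz.le)]
        _ ≤ g₁ z + g₂ z := le_add_self
  have hg₁m : Measurable g₁ := measurable_ofReal_inv_norm_pow_six.const_mul _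
  unfold errTerm
  calc ∫⁻ z, ENNReal.ofReal (‖z‖⁻¹ ^ 6) * phaseOut L z ∂((Measure.count : Measure E3).restrict S)
      ≤ ∫⁻ z, g₁ z + g₂ z ∂((Measure.count : Measure E3).restrict S) := lintegral_mono hpt
    _ = ∫⁻ z, g₁ z ∂((Measure.count : Measure E3).restrict S) +
          ∫⁻ z, g₂ z ∂((Measure.count : Measure E3).restrict S) := lintegral_add_left hg₁m _
    _ ≤ 6 * ENNReal.ofReal (ρ / L) * ENNReal.ofReal (250 * δ⁻¹ ^ 6) +
          volume phaseDom * ENNReal.ofReal (1000 * δ⁻¹ ^ 4 * ρ⁻¹ ^ 2) := by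
        refine add_le_add ?_ ?_
        · rw [hg₁, lintegral_const_mul _ measurable_ofReal_inv_norm_pow_six]
          exact mul_le_mul' le_rfl (lintegral_inv_six_le_of_hc hδ hμ')
        · rw [hg₂, lintegral_const_mul'' _
            ((measurable_ofReal_inv_norm_pow_six.indicator
              (measurableSet_le measurable_const measurable_norm)).aemeasurable)]
          exact mul_le_mul' le_rfl (lintegral_indicator_inv_six_le hδ hδρ hsep)


/-! ## The transport on hard-core configurations: bounded, of finite range, measurable once re-rooted -/

/-- The hard-core bound of the transported share: on a rooted `δ`-hard-core configuration every cell of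
the root holds the root (mass `≥ 1`) and has local energy `≤ 250/24·δ⁻¹²`, so
`share ≤ 250/24·δ⁻¹² + C_δ`. -/
theorem share_rootCell_le {δ L : ℝ} (hδ : 0 < δ) {μ : Measure E3} (hμ : IsRootedHardCore δ μ) (v : E3) :
    share δ μ (rootCell L v) ≤ ENNReal.ofReal (250 / 24 * δ⁻¹ ^ 12 + cst δ) := by
  have hmem := mem_hcClass_of_hc hδ hμ
  have hden : 1 ≤ trunc δ μ (rootCell L v) := by
    rw [trunc_of_mem hmem, ← hμ.measure_zero_singleton]
    exact measure_mono (singleton_subset_iff.2 (zero_mem_rootCell L v))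
  have hnum : locEnergy δ μ (rootCell L v) + cst δ ≤ 250 / 24 * δ⁻¹ ^ 12 + cst δ := by
    have hpos : locPos δ μ (rootCell L v) ≤ ENNReal.ofReal (250 / 12 * δ⁻¹ ^ 12) := by
      unfold locPos
      rw [trunc_of_mem hmem]
      exact (lintegral_mono fun z => indicator_le_self _ _ z).trans (lintegral_pos_le_of_hc hδ hμ)
    have h1 : (locPos δ μ (rootCell L v)).toReal ≤ 250 / 12 * δ⁻¹ ^ 12 :=
      ENNReal.toReal_le_of_le_ofReal (by positivity) hpos
    have h2 : 0 ≤ (locNeg δ μ (rootCell L v)).toReal := ENNReal.toReal_nonneg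
    unfold locEnergy
    linarith
  unfold share
  calc ENNReal.ofReal (locEnergy δ μ (rootCell L v) + cst δ) / trunc δ μ (rootCell L v)
      ≤ ENNReal.ofReal (locEnergy δ μ (rootCell L v) + cst δ) / 1 := ENNReal.div_le_div_left hden _
    _ = ENNReal.ofReal (locEnergy δ μ (rootCell L v) + cst δ) := by rw [div_one]
    _ ≤ ENNReal.ofReal (250 / 24 * δ⁻¹ ^ 12 + cst δ) := ENNReal.ofReal_le_ofReal hnum

/-- **The transport is bounded on rooted hard-core configurations**:
`transport δ L μ y ≤ vol [0,1)³ · (250/24·δ⁻¹² + C_δ)`. -/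
theorem transport_le_of_hc {δ L : ℝ} (hδ : 0 < δ) {μ : Measure E3} (hμ : IsRootedHardCore δ μ) (y : E3) :
    transport δ L μ y ≤ volume phaseDom * ENNReal.ofReal (250 / 24 * δ⁻¹ ^ 12 + cst δ) := by
  unfold transport
  calc ∫⁻ v in phaseDom, (rootCell L v).indicator (fun _ => share δ μ (rootCell L v)) y
      ≤ ∫⁻ _ in phaseDom, ENNReal.ofReal (250 / 24 * δ⁻¹ ^ 12 + cst δ) :=
        lintegral_mono fun v => (indicator_le_self _ _ y).trans (share_rootCell_le hδ hμ v)
    _ = volume phaseDom * ENNReal.ofReal (250 / 24 * δ⁻¹ ^ 12 + cst δ) := by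
        rw [setLIntegral_const, mul_comm]

/-- **The transport has range `2L`**: nothing is sent beyond the root's cell, which lies in `B̄(0, 2L)`. -/
theorem transport_eq_zero_of_lt {δ L : ℝ} (hL : 0 < L) (μ : Measure E3) {y : E3} (hy : 2 * L < ‖y‖) :
    transport δ L μ y = 0 := by
  unfold transport
  have h : ∀ v, (rootCell L v).indicator (fun _ => share δ μ (rootCell L v)) y = 0 := fun v =>
    indicator_of_notMem (fun hmem => by
      have := rootCell_subset_closedBall hL v hmem
      rw [Metric.mem_closedBall, dist_zero_right] at this
      linarith) _
  simp_rw [h]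
  exact lintegral_zero

/-- **The received transport is measurable in the sending atom** (for a configuration of the packing
class): `y ↦ transport δ L (θ_y μ) (−y)` is measurable, through the s-finite truncated kernel
(`PalmUnimodularRigidity.measurable_map_sub_kernel`). -/
theorem measurable_transport_map_sub {δ L : ℝ} {μ : Measure E3} (hμ : μ ∈ hcClass δ) :
    Measurable fun y : E3 => transport δ L (μ.map fun z => z - y) (-y) := by
  have h1 : Measurable fun p : Measure E3 × E3 => ((truncKernel δ) p.1).map (fun z => z - p.2) :=
    PalmUnimodularRigidity.measurable_map_sub_kernel (truncKernel δ)
  have h2 : Measurable fun y : E3 => ((truncKernel δ) μ).map (fun z => z - y) :=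
    h1.comp (measurable_const.prodMk measurable_id)
  have hk : (truncKernel δ) μ = μ := by
    rw [truncKernel_apply, trunc_of_mem hμ]
  rw [hk] at h2
  -- compose in `∘`-form first (direct elaboration against the `fun`-form is a defeq timeout)
  have h3 : Measurable ((Function.uncurry (transport δ L)) ∘ fun y : E3 => (μ.map (fun z => z - y), -y)) :=
    (measurable_transport δ L).comp (h2.prodMk measurable_neg)
  rw [Function.comp_def] at h3
  exact h3

/-! ## Registered marker -/

/-- Registered sub-goal `stub_slackCertificates_part01` (helper part 1/2 of `stub_slackCertificates`, line
`octahedral-annulus-mandate`): the UNIFORM boundary-error bound `errTerm_le_uniform`, closed form. -/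
theorem stub_slackCertificates_part01 : ∀ δ L ρ : ℝ, 0 < δ → 0 < L → δ ≤ ρ → ∀ μ : Measure E3, IsRootedHardCore δ μ → errTerm L μ ≤ 6 * ENNReal.ofReal (ρ / L) * ENNReal.ofReal (250 * δ⁻¹ ^ 6) + volume phaseDom * ENNReal.ofReal (1000 * δ⁻¹ ^ 4 * ρ⁻¹ ^ 2) :=
  fun _ _ _ hδ hL hδρ _ hμ => errTerm_le_uniform hδ hL hδρ hμ

end Summit.AtomisticToContinuum.Crystallization.Theorems.PalmUnimodularRigidityMinimiserShells.SlackCertificates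

end
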